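import Literature.AlgebraicGeometry.Modules.ModuleCechComplex
import Literature.Algebra.Homology.OrderedCechSystemMap
import Mathlib.Topology.Sheaves.SheafCondition.UniqueGluing
import HarnessLib

/-!
# `Ȟ⁰ = Γ(X, L)` for the module Čech complex (Görtz–Wedhorn II, Lemma 21.65)

Sequel to `Modules/ModuleCechComplex`: for a cover `𝓥 = (V_i)_{i ∈ ι}` of the scheme `X` (`⨆ V_i = ⊤`), an
`𝒪_X`-module `L` and a base ring `ρ : A → Γ(X, 𝒪_X)`,

* `Modules.cechAugment` — the augmentation `Γ(L, X) → Č⁰(𝓥, L)`, `t ↦ (t|_{V_i})_i`, landing in the cocycles;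
* `Modules.vertexSection`, `Modules.existsUnique_glue` — a `0`-cocycle is a compatible family on the `V_i`, which
  glues uniquely (sheaf axiom, Mathlib `TopCat.Sheaf.existsUnique_gluing'`);
* **`Modules.kerDZeroEquiv : SecMod L ρ ⊤ ≃ₗ[A] ker d⁰`** — `A`-linear for the `Module.compHom` structure.

Everything is proved; no named facts.  Cell `hodgecm-mathlib`, M13 node N1 (1a-α) (B-p10 (g8), cut/couriered by
B-p15 (g8) per B-plan1 R140); generic, books 0.

## References

* U. Görtz, T. Wedhorn, *Algebraic Geometry II: Cohomology of Schemes* (2023), Lemma 21.65, Def. 21.68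
  (pp. 179–180). [GortzWedhorn2023]
* D. Mumford, *Abelian Varieties*, TIFR Studies in Mathematics 5 (1970), §5. [MumfordAV1970]
-/

universe u

open CategoryTheory AlgebraicGeometry TopologicalSpace Opposite
open Literature.Algebra.Homology Literature.AlgebraicGeometry.Motives

set_option backward.isDefEq.respectTransparency false

noncomputable section

namespace Literature.AlgebraicGeometry.Modules

variable {X : Scheme.{u}} {ι : Type} (𝓥 : ι → X.Opens) (L : X.Modules)
variable {A : Type u} [CommRing A] (ρ : A →+* Γ(X, ⊤))

variable [LinearOrder ι]

/-- **The augmentation `Γ(L, X) → Č⁰(𝓥, L)`, `t ↦ (t|_{V_i})_i`.** [cite: GortzWedhorn2023, Lemma 21.65 (p. 179)] -/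
def cechAugment : SecMod L ρ ⊤ →ₗ[A] OrderedCech.SysCochain (sectionsSystem 𝓥 L ρ) 0 :=
  LinearMap.pi fun σ => SecMod.res L ρ (le_top : cechOpen 𝓥 σ.1 ≤ ⊤)

/-- Components of the augmentation. [folklore] [cite: GortzWedhorn2023, Def. 21.68 (p. 180)] -/
@[simp] theorem cechAugment_apply (t : SecMod L ρ ⊤) (σ : OrderedCech.Simplex ι 0) :
    cechAugment 𝓥 L ρ t σ = SecMod.res L ρ (le_top : cechOpen 𝓥 σ.1 ≤ ⊤) t := rfl

/-- The augmentation lands in the cocycles: `d⁰ (t|_{V_i})_i = 0`. [folklore] [cite: GortzWedhorn2023, Def. 21.68 (p. 180)] -/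
theorem sysD_cechAugment (t : SecMod L ρ ⊤) :
    OrderedCech.sysD (sectionsSystem 𝓥 L ρ) 0 (cechAugment 𝓥 L ρ t) = 0 := by
  rw [OrderedCech.sysD_zero_eq_zero_iff]
  intro a b hab
  rw [cechAugment_apply, cechAugment_apply, sectionsSystem_map_apply, sectionsSystem_map_apply]
  erw [SecMod.res_res, SecMod.res_res]

/-- The restriction of a cocycle's vertex value to `V_i` (transport along `V_{{i}} = V_i`). [folklore] [cite: GortzWedhorn2023, Def. 21.68 (p. 180)] -/
def vertexSection (g : OrderedCech.SysCochain (sectionsSystem 𝓥 L ρ) 0) (i : ι) : Γ(L, 𝓥 i) :=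
  SecMod.val (SecMod.res L ρ (cechOpen_singleton 𝓥 i).symm.le (g (OrderedCech.vertex i)))

/-- For a cocycle, the vertex sections are compatible on overlaps. [folklore] [cite: GortzWedhorn2023, Def. 21.68 (p. 180)] -/
theorem vertexSection_compatible (g : OrderedCech.SysCochain (sectionsSystem 𝓥 L ρ) 0)
    (hg : OrderedCech.sysD (sectionsSystem 𝓥 L ρ) 0 g = 0) :
    TopCat.Presheaf.IsCompatible L.presheaf 𝓥 (vertexSection 𝓥 L ρ g) := by
  rw [OrderedCech.sysD_zero_eq_zero_iff] at hg
  -- the restrictions of `g_i` and `g_j` to `V_i ⊓ V_j` agree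
  have key : ∀ (i j : ι), L.presheaf.map (homOfLE (inf_le_left : 𝓥 i ⊓ 𝓥 j ≤ 𝓥 i)).op (vertexSection 𝓥 L ρ g i) =
      L.presheaf.map (homOfLE (inf_le_right : 𝓥 i ⊓ 𝓥 j ≤ 𝓥 j)).op (vertexSection 𝓥 L ρ g j) := by
    -- reduce to `i < j` (and `i = j`)
    suffices h : ∀ i j : ι, i < j →
        L.presheaf.map (homOfLE (inf_le_left : 𝓥 i ⊓ 𝓥 j ≤ 𝓥 i)).op (vertexSection 𝓥 L ρ g i) =
          L.presheaf.map (homOfLE (inf_le_right : 𝓥 i ⊓ 𝓥 j ≤ 𝓥 j)).op (vertexSection 𝓥 L ρ g j) by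
      intro i j
      rcases lt_trichotomy i j with hij | rfl | hji
      · exact h i j hij
      · rfl
      · -- swap the roles, transporting along `V_j ⊓ V_i = V_i ⊓ V_j`
        have e : 𝓥 i ⊓ 𝓥 j = 𝓥 j ⊓ 𝓥 i := inf_comm _ _
        have := congrArg (L.presheaf.map (homOfLE e.le).op) (h j i hji)
        change (L.presheaf.map _ ≫ L.presheaf.map _) _ = (L.presheaf.map _ ≫ L.presheaf.map _) _ at this
        rw [← Functor.map_comp, ← op_comp, ← Functor.map_comp, ← op_comp] at this
        exact this.symm
    intro i j hij
    have hc := hg i j hij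
    -- both sides of `hc` live in `Γ(L, V_{{i,j}})`; restrict/transport them to `V_i ⊓ V_j`
    have e2 : cechOpen 𝓥 {i, j} = 𝓥 i ⊓ 𝓥 j := cechOpen_pair 𝓥 i j
    have hc' := congrArg (fun y => SecMod.val (SecMod.res L ρ e2.symm.le y)) hc
    simp only [sectionsSystem_map_apply, SecMod.res_res] at hc'
    -- rewrite each side as the restriction from `V_i` (resp. `V_j`)
    unfold vertexSection
    rw [← SecMod.val_res (ρ := ρ), ← SecMod.val_res (ρ := ρ), SecMod.res_res, SecMod.res_res]
    exact hc'
  exact fun i j => key i j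

/-- **Existence and uniqueness of the glued global section of a cocycle** (`V_i` covering `X`).
[cite: GortzWedhorn2023, Lemma 21.65 (p. 179)] -/
theorem existsUnique_glue (hcov : ⨆ i, 𝓥 i = ⊤) (g : OrderedCech.SysCochain (sectionsSystem 𝓥 L ρ) 0)
    (hg : OrderedCech.sysD (sectionsSystem 𝓥 L ρ) 0 g = 0) :
    ∃! t : Γ(L, ⊤), ∀ i, L.presheaf.map (homOfLE (le_top : 𝓥 i ≤ ⊤)).op t = vertexSection 𝓥 L ρ g i :=
  TopCat.Sheaf.existsUnique_gluing' ((SheafOfModules.toSheaf _).obj L) 𝓥 ⊤ (fun _ => homOfLE le_top)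
    (le_of_eq hcov.symm) (vertexSection 𝓥 L ρ g) (vertexSection_compatible 𝓥 L ρ g hg)

omit [LinearOrder ι] in
/-- A global section is determined by its restrictions to the `V_i`. [folklore] [cite: GortzWedhorn2023, Def. 21.68 (p. 180)] -/
theorem eq_of_forall_res_eq (hcov : ⨆ i, 𝓥 i = ⊤) (t t' : Γ(L, ⊤))
    (h : ∀ i, L.presheaf.map (homOfLE (le_top : 𝓥 i ≤ ⊤)).op t = L.presheaf.map (homOfLE (le_top : 𝓥 i ≤ ⊤)).op t') :
    t = t' :=
  TopCat.Sheaf.eq_of_locally_eq' ((SheafOfModules.toSheaf _).obj L) 𝓥 ⊤ (fun _ => homOfLE le_top)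
    (le_of_eq hcov.symm) t t' h

/-- The vertex sections of the augmentation of `t` are the restrictions of `t`. [folklore] [cite: GortzWedhorn2023, Def. 21.68 (p. 180)] -/
theorem vertexSection_cechAugment (t : SecMod L ρ ⊤) (i : ι) :
    vertexSection 𝓥 L ρ (cechAugment 𝓥 L ρ t) i = L.presheaf.map (homOfLE (le_top : 𝓥 i ≤ ⊤)).op (SecMod.val t) := by
  change SecMod.val (SecMod.res L ρ _ (SecMod.res L ρ _ t)) = _
  erw [SecMod.res_res]
  rfl

/-- The augmentation is injective (a global section vanishing on a cover vanishes). [folklore] [cite: GortzWedhorn2023, Def. 21.68 (p. 180)] -/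
theorem cechAugment_injective (hcov : ⨆ i, 𝓥 i = ⊤) : Function.Injective (cechAugment 𝓥 L ρ) := by
  intro t t' h
  apply SecMod.val_injective
  refine eq_of_forall_res_eq 𝓥 L hcov _ _ fun i => ?_
  rw [← vertexSection_cechAugment, ← vertexSection_cechAugment, h]

/-- Every cocycle is the augmentation of a (glued) global section. [folklore] [cite: GortzWedhorn2023, Def. 21.68 (p. 180)] -/
theorem exists_cechAugment_eq (hcov : ⨆ i, 𝓥 i = ⊤) (g : OrderedCech.SysCochain (sectionsSystem 𝓥 L ρ) 0)
    (hg : OrderedCech.sysD (sectionsSystem 𝓥 L ρ) 0 g = 0) : ∃ t, cechAugment 𝓥 L ρ t = g := by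
  obtain ⟨t, ht, -⟩ := existsUnique_glue 𝓥 L ρ hcov g hg
  refine ⟨SecMod.mk t, funext fun σ => ?_⟩
  obtain ⟨i, rfl⟩ := OrderedCech.exists_eq_vertex σ
  -- compare after transporting to `V_i` (restriction along an equality of opens is injective)
  have hinj : Function.Injective (SecMod.res L ρ (cechOpen_singleton 𝓥 i).symm.le :
      SecMod L ρ (cechOpen 𝓥 {i}) → SecMod L ρ (𝓥 i)) := by
    intro x y hxy
    have := congrArg (SecMod.res L ρ (cechOpen_singleton 𝓥 i).le) hxy
    rwa [SecMod.res_res, SecMod.res_res, SecMod.res_self, SecMod.res_self] at this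
  apply hinj
  apply SecMod.val_injective
  change vertexSection 𝓥 L ρ (cechAugment 𝓥 L ρ (SecMod.mk t)) i = vertexSection 𝓥 L ρ g i
  rw [vertexSection_cechAugment]
  exact ht i

/-- **`Ȟ⁰(𝓥, L) = Γ(X, L)`: the augmentation is an `A`-linear isomorphism onto the `0`-cocycles** (the
`V_i` covering `X`; Görtz–Wedhorn II, Lemma 21.65: "the natural map `Γ(U, 𝓕) → Ȟ⁰(𝓤, 𝓕)` is an
isomorphism"). [cite: GortzWedhorn2023, Lemma 21.65 (p. 179)] -/
def kerDZeroEquiv (hcov : ⨆ i, 𝓥 i = ⊤) :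
    SecMod L ρ ⊤ ≃ₗ[A] LinearMap.ker (OrderedCech.sysD (sectionsSystem 𝓥 L ρ) 0) :=
  LinearEquiv.ofBijective
    (LinearMap.codRestrict _ (cechAugment 𝓥 L ρ) fun t => sysD_cechAugment 𝓥 L ρ t)
    ⟨fun t t' h => cechAugment_injective 𝓥 L ρ hcov (congrArg Subtype.val h),
      fun g => by
        obtain ⟨t, ht⟩ := exists_cechAugment_eq 𝓥 L ρ hcov g.1 g.2
        exact ⟨t, Subtype.ext ht⟩⟩

/-- The isomorphism `Γ(X, L) ≅ ker d⁰` is the augmentation. [folklore] [cite: GortzWedhorn2023, Def. 21.68 (p. 180)] -/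
@[simp] theorem coe_kerDZeroEquiv_apply (hcov : ⨆ i, 𝓥 i = ⊤) (t : SecMod L ρ ⊤) :
    ((kerDZeroEquiv 𝓥 L ρ hcov t : LinearMap.ker _) : OrderedCech.SysCochain (sectionsSystem 𝓥 L ρ) 0) =
      cechAugment 𝓥 L ρ t := rfl

end Literature.AlgebraicGeometry.Modules

end
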